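import Literature.NumberTheory.EllipticCurves.KatzPAdicLFunctionCMFieldLocalDataProofs
import HarnessLib

/-!
# Local data of Katz's measure, III: `ord_w` of `2ϑ = a·y + b·x` — the non-archimedean evaluations of
# Hsieh's (d2) recipe (unit / tame / dyadic `−4` / dyadic `−8` primes)

PROOF-ONLY sequel of `KatzPAdicLFunctionCMFieldLocalDataProofs.lean` (no definition, no named fact, no
`sorry`). Purpose (route `BiquadraticEisensteinDescent`, crux stmt-BirchSwinnertonDyer-21341, line
`hsieh-lambda`, layer 2; memo `Cruxes/EisensteinHeartFlatCMInertBadKPrime/INSTANTIATION-L-BIQUADRATIC.md`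
§ADDENDUM 3): Hsieh's hypothesis (d2) `ord_w(2ϑ) = d_w(L/ℚ)` on the finite set `D` is met at
`L = K′(√d_CM)` by `2ϑ := a·y + b·x` (`y = √d_{K′} ∈ K′`, `x = √d_CM`, `a, b ∈ ℤ` chosen by CRT); this
file evaluates the LEFT side prime by prime from the strong triangle (in)equality:

* §1 `ordAt_neg`, `ordAt_add_eq_left_of_lt` / `_right_of_lt` — `ord_w(u + v) = ord_w(u)` if
  `ord_w(u) < ord_w(v)` (`u ≠ 0`; Mathlib `Valuation.map_add_eq_of_lt_left`).
* §2 integers at `w ∣ ℓ`: `ordAt_intCast_eq_zero_of_not_dvd` (`ℓ ∤ a ⟹ ord_w(a) = 0`),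
  `ramificationIdx_le_ordAt_intCast_of_dvd` (`ℓ ∣ a ≠ 0 ⟹ e(w∣ℓ) ≤ ord_w(a)`),
  `ordAt_intCast_eq_ramificationIdx_of_dvd_of_not_dvd` (`ℓ ∥ a ⟹ ord_w(a) = e(w∣ℓ)`),
  `two_mul_ramificationIdx_le_ordAt_intCast_of_sq_dvd` (`ℓ² ∣ a ≠ 0 ⟹ 2e ≤ ord_w(a)`).
* §3 square roots: `two_mul_ordAt_of_sq_eq` (`x² = c ⟹ 2·ord_w(x) = ord_w(c)`), `ordAt_eq_zero_of_sq_eq_intCast`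
  (`x² = d`, `ℓ ∤ d ⟹ ord_w(x) = 0`), `ordAt_eq_one_of_sq_eq_intCast` (`ℓ ∥ d`, `e(w∣ℓ) = 2 ⟹ ord_w(x) = 1`),
  `ordAt_eq_of_sq_eq_neg_four` (`x² = −4`, `e(w∣2) = 2 ⟹ ord_w(x) = 2`), `ordAt_eq_of_sq_eq_neg_eight`
  (`x² = −8`, `e(w∣2) = 2 ⟹ ord_w(x) = 3`).
* §4 THE FOUR EVALUATIONS of `ord_w(a·y + b·x)` (`a b : ℤ`, `y` integral):
  `ordAt_lin_eq_zero` (unit primes: `ord_w(y) = 0`, `ℓ ∤ a`, `ℓ ∣ b`, `x` integral ⟹ `0`),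
  `ordAt_lin_eq_one` (tame: `ord_w(x) = 1`, `ℓ ∤ b`, `ℓ ∣ a` ⟹ `1`),
  `ordAt_lin_eq_two` (dyadic `−4`: `ord_w(x) = 2`, `e = 2`, `2 ∥ a`, `ord_w(y) = 0`, `2 ∣ b` ⟹ `2`),
  `ordAt_lin_eq_three` (dyadic `−8`: `ord_w(x) = 3`, `e = 2`, `2 ∤ b`, `4 ∣ a` ⟹ `3`)
  — matching `d_w = 0 / 1 / 2 / 3` of files I–II at the unramified / odd `ℓ ∣ d_CM` / `2 ∣ d_CM = −4` /
  `d_CM = −8` primes.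

References: [cite: NeukirchANT1999, Ch. II §3–§4 (non-archimedean valuations: the strong triangle
inequality), Ch. I §8, §11]; [cite: Hsieh2014mu, §3.1 (d2)].
-/

set_option autoImplicit false

noncomputable section

open scoped nonZeroDivisors NumberField

namespace Literature.NumberTheory.EllipticCurves

open NumberField IsDedekindDomain

variable {K : Type} [Field K] [NumberField K]

/-! ## §1 The strong triangle inequality for `ordAt` -/

/-- `ord_w(−u) = ord_w(u)`. [cite: NeukirchANT1999, Ch. II §3 (valuations)] -/
theorem ordAt_neg (w : HeightOneSpectrum (𝓞 K)) (u : K) : ordAt w (-u) = ordAt w u := by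
  rw [ordAt_eq_ord, ordAt_eq_ord]
  unfold Literature.IUT.LogVolume.ord
  rw [Valuation.map_neg]

/-- **Strong triangle inequality, strict case: `ord_w(u + v) = ord_w(u)` when `ord_w(u) < ord_w(v)`** (`u ≠ 0`).
[cite: NeukirchANT1999, Ch. II §3 (the strong triangle inequality)] -/
theorem ordAt_add_eq_left_of_lt (w : HeightOneSpectrum (𝓞 K)) {u v : K} (hu : u ≠ 0)
    (h : ordAt w u < ordAt w v) : ordAt w (u + v) = ordAt w u := by
  by_cases hv : v = 0
  · rw [hv, add_zero]
  rw [ordAt_eq_ord, ordAt_eq_ord] at h ⊢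
  unfold Literature.IUT.LogVolume.ord at h ⊢
  have hu' : w.valuation K u ≠ 0 := (Valuation.ne_zero_iff _).mpr hu
  have hv' : w.valuation K v ≠ 0 := (Valuation.ne_zero_iff _).mpr hv
  have hlt : w.valuation K v < w.valuation K u := by
    rw [← WithZero.log_lt_log hv' hu']
    omega
  rw [Valuation.map_add_eq_of_lt_left _ hlt]

/-- Symmetric form: `ord_w(u + v) = ord_w(v)` when `ord_w(v) < ord_w(u)` (`v ≠ 0`).
[cite: NeukirchANT1999, Ch. II §3 (the strong triangle inequality)] -/
theorem ordAt_add_eq_right_of_lt (w : HeightOneSpectrum (𝓞 K)) {u v : K} (hv : v ≠ 0)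
    (h : ordAt w v < ordAt w u) : ordAt w (u + v) = ordAt w v := by
  rw [add_comm]
  exact ordAt_add_eq_left_of_lt w hv h

/-! ## §2 Integers at a prime `w ∣ ℓ` -/

/-- **`ℓ ∤ a ⟹ ord_w(a) = 0`** at `w ∣ ℓ` (`w ∩ ℤ = ℓℤ`). [cite: NeukirchANT1999, Ch. I §8, §11] -/
theorem ordAt_intCast_eq_zero_of_not_dvd {ℓ : ℕ} (hℓ : ℓ.Prime) (w : HeightOneSpectrum (𝓞 K))
    (hw : ((ℓ : ℕ) : 𝓞 K) ∈ w.asIdeal) {a : ℤ} (ha : ¬ (ℓ : ℤ) ∣ a) : ordAt w (a : K) = 0 := by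
  have ha0 : a ≠ 0 := by rintro rfl; exact ha (dvd_zero _)
  refine ordAt_intCast_eq_zero_of_not_mem w ha0 fun hmem ↦ ha ?_
  have : a ∈ w.asIdeal.under ℤ := by
    rw [Ideal.mem_comap]
    simpa using hmem
  rw [under_int_eq_span_of_natCast_mem hℓ w hw, Ideal.mem_span_singleton] at this
  exact this

/-- **`ℓ ∣ a ≠ 0 ⟹ e(w∣ℓ) ≤ ord_w(a)`** at `w ∣ ℓ`. [cite: NeukirchANT1999, Ch. I §8, §11] -/
theorem ramificationIdx_le_ordAt_intCast_of_dvd {ℓ : ℕ} (hℓ : ℓ.Prime) (w : HeightOneSpectrum (𝓞 K))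
    (hw : ((ℓ : ℕ) : 𝓞 K) ∈ w.asIdeal) {a : ℤ} (ha0 : a ≠ 0) (ha : (ℓ : ℤ) ∣ a) :
    (w.asIdeal.ramificationIdx ℤ : ℤ) ≤ ordAt w (a : K) := by
  obtain ⟨m, rfl⟩ := ha
  have hm0 : m ≠ 0 := by rintro rfl; simp at ha0
  rw [Int.cast_mul, Int.cast_natCast, ordAt_mul w (by exact_mod_cast hℓ.ne_zero) (by exact_mod_cast hm0),
    ordAt_natCast_eq_ramificationIdx hℓ w hw, show (m : K) = (((m : ℤ) : 𝓞 K) : K) by simp]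
  have := ordAt_nonneg_of_isIntegral w ((m : ℤ) : 𝓞 K)
  omega

/-- **`ℓ ∥ a ⟹ ord_w(a) = e(w∣ℓ)`** at `w ∣ ℓ`. [cite: NeukirchANT1999, Ch. I §8, §11] -/
theorem ordAt_intCast_eq_ramificationIdx_of_dvd_of_not_dvd {ℓ : ℕ} (hℓ : ℓ.Prime)
    (w : HeightOneSpectrum (𝓞 K)) (hw : ((ℓ : ℕ) : 𝓞 K) ∈ w.asIdeal) {a : ℤ} (ha : (ℓ : ℤ) ∣ a)
    (ha2 : ¬ ((ℓ : ℤ) ^ 2) ∣ a) : ordAt w (a : K) = w.asIdeal.ramificationIdx ℤ := by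
  obtain ⟨m, rfl⟩ := ha
  have hm : ¬ (ℓ : ℤ) ∣ m := by rintro ⟨k, rfl⟩; exact ha2 ⟨k, by ring⟩
  have hm0 : m ≠ 0 := by rintro rfl; exact hm (dvd_zero _)
  rw [Int.cast_mul, Int.cast_natCast, ordAt_mul w (by exact_mod_cast hℓ.ne_zero) (by exact_mod_cast hm0),
    ordAt_natCast_eq_ramificationIdx hℓ w hw, ordAt_intCast_eq_zero_of_not_dvd hℓ w hw hm, add_zero]

/-- **`ℓ² ∣ a ≠ 0 ⟹ 2·e(w∣ℓ) ≤ ord_w(a)`** at `w ∣ ℓ`. [cite: NeukirchANT1999, Ch. I §8, §11] -/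
theorem two_mul_ramificationIdx_le_ordAt_intCast_of_sq_dvd {ℓ : ℕ} (hℓ : ℓ.Prime)
    (w : HeightOneSpectrum (𝓞 K)) (hw : ((ℓ : ℕ) : 𝓞 K) ∈ w.asIdeal) {a : ℤ} (ha0 : a ≠ 0)
    (ha : ((ℓ : ℤ) ^ 2) ∣ a) : 2 * (w.asIdeal.ramificationIdx ℤ : ℤ) ≤ ordAt w (a : K) := by
  obtain ⟨m, rfl⟩ := ha
  have hm0 : m ≠ 0 := by rintro rfl; simp at ha0
  have hℓ0 : (ℓ : K) ≠ 0 := by exact_mod_cast hℓ.ne_zero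
  rw [Int.cast_mul, Int.cast_pow, Int.cast_natCast, ordAt_mul w (pow_ne_zero 2 hℓ0) (by exact_mod_cast hm0),
    ordAt_pow, ordAt_natCast_eq_ramificationIdx hℓ w hw, show (m : K) = (((m : ℤ) : 𝓞 K) : K) by simp]
  have := ordAt_nonneg_of_isIntegral w ((m : ℤ) : 𝓞 K)
  push_cast
  omega

/-! ## §3 Square roots -/

/-- `x² = c ⟹ 2·ord_w(x) = ord_w(c)`. [cite: NeukirchANT1999, Ch. I §11] -/
theorem two_mul_ordAt_of_sq_eq (w : HeightOneSpectrum (𝓞 K)) {x c : K} (hx : x ^ 2 = c) :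
    2 * ordAt w x = ordAt w c := by
  rw [← hx, ordAt_pow]
  rfl

omit [NumberField K] in
/-- An element whose square is an integer is integral. [cite: NeukirchANT1999, Ch. I §2 (integrality)] -/
theorem isIntegral_of_sq_eq_intCast {x : K} {d : ℤ} (hx : x ^ 2 = (d : K)) : IsIntegral ℤ x := by
  have hd : IsIntegral ℤ ((d : ℤ) : K) := by
    simpa using (isIntegral_algebraMap : IsIntegral ℤ (algebraMap ℤ K d))
  exact IsIntegral.of_pow two_pos (by rwa [hx])

/-- `x² = d ∈ ℤ ⟹ ord_w(x) ≥ 0`. [cite: NeukirchANT1999, Ch. I §11] -/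
theorem ordAt_nonneg_of_sq_eq_intCast (w : HeightOneSpectrum (𝓞 K)) {x : K} {d : ℤ} (hx : x ^ 2 = (d : K)) :
    0 ≤ ordAt w x := by
  have h := ordAt_nonneg_of_isIntegral w ⟨x, isIntegral_of_sq_eq_intCast hx⟩
  simpa using h

/-- **`x² = d`, `ℓ ∤ d ⟹ ord_w(x) = 0`** at `w ∣ ℓ`. [cite: NeukirchANT1999, Ch. I §11] -/
theorem ordAt_eq_zero_of_sq_eq_intCast {ℓ : ℕ} (hℓ : ℓ.Prime) (w : HeightOneSpectrum (𝓞 K))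
    (hw : ((ℓ : ℕ) : 𝓞 K) ∈ w.asIdeal) {x : K} {d : ℤ} (hx : x ^ 2 = (d : K)) (hd : ¬ (ℓ : ℤ) ∣ d) :
    ordAt w x = 0 := by
  have h := two_mul_ordAt_of_sq_eq w hx
  rw [ordAt_intCast_eq_zero_of_not_dvd hℓ w hw hd] at h
  omega

/-- **`x² = d`, `ℓ ∥ d`, `e(w∣ℓ) = 2 ⟹ ord_w(x) = 1`** at `w ∣ ℓ` (the ramified odd primes `ℓ ∣ d_CM` of `K′(√d_CM)`).
[cite: NeukirchANT1999, Ch. I §8, §11] -/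
theorem ordAt_eq_one_of_sq_eq_intCast {ℓ : ℕ} (hℓ : ℓ.Prime) (w : HeightOneSpectrum (𝓞 K))
    (hw : ((ℓ : ℕ) : 𝓞 K) ∈ w.asIdeal) {x : K} {d : ℤ} (hx : x ^ 2 = (d : K)) (hd : (ℓ : ℤ) ∣ d)
    (hd2 : ¬ ((ℓ : ℤ) ^ 2) ∣ d) (he : w.asIdeal.ramificationIdx ℤ = 2) : ordAt w x = 1 := by
  have h := two_mul_ordAt_of_sq_eq w hx
  rw [ordAt_intCast_eq_ramificationIdx_of_dvd_of_not_dvd hℓ w hw hd hd2, he] at h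
  push_cast at h
  omega

/-- **`x² = −4`, `e(w∣2) = 2 ⟹ ord_w(x) = 2`** at `w ∣ 2` (`x = 2i`; `d_CM = −4`). [cite: NeukirchANT1999, Ch. I §8, §11] -/
theorem ordAt_eq_of_sq_eq_neg_four (w : HeightOneSpectrum (𝓞 K)) (hw : ((2 : ℕ) : 𝓞 K) ∈ w.asIdeal)
    {x : K} (hx : x ^ 2 = -4) (he : w.asIdeal.ramificationIdx ℤ = 2) : ordAt w x = 2 := by
  have h := two_mul_ordAt_of_sq_eq w hx
  have h4 : ordAt w (-4 : K) = 2 * (w.asIdeal.ramificationIdx ℤ : ℤ) := by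
    rw [ordAt_neg, show (4 : K) = (2 : K) ^ 2 by norm_num, ordAt_pow,
      show (2 : K) = ((2 : ℕ) : K) by norm_num, ordAt_natCast_eq_ramificationIdx Nat.prime_two w hw]
    rfl
  rw [h4, he] at h
  push_cast at h
  omega

/-- **`x² = −8`, `e(w∣2) = 2 ⟹ ord_w(x) = 3`** at `w ∣ 2` (`x = 2√−2`; `d_CM = −8`). [cite: NeukirchANT1999, Ch. I §8, §11] -/
theorem ordAt_eq_of_sq_eq_neg_eight (w : HeightOneSpectrum (𝓞 K)) (hw : ((2 : ℕ) : 𝓞 K) ∈ w.asIdeal)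
    {x : K} (hx : x ^ 2 = -8) (he : w.asIdeal.ramificationIdx ℤ = 2) : ordAt w x = 3 := by
  have h := two_mul_ordAt_of_sq_eq w hx
  have h8 : ordAt w (-8 : K) = 3 * (w.asIdeal.ramificationIdx ℤ : ℤ) := by
    rw [ordAt_neg, show (8 : K) = (2 : K) ^ 3 by norm_num, ordAt_pow,
      show (2 : K) = ((2 : ℕ) : K) by norm_num, ordAt_natCast_eq_ramificationIdx Nat.prime_two w hw]
    rfl
  rw [h8, he] at h
  push_cast at h
  omega

/-! ## §4 The four evaluations of `ord_w(a·y + b·x)` -/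

/-- **UNIT PRIMES: `ord_w(a·y + b·x) = 0`** when `y` is a unit at `w ∣ ℓ` (`ord_w(y) = 0`, `y ≠ 0`), `ℓ ∤ a`,
`ℓ ∣ b` and `x` has `ord_w(x) ≥ 0` (e.g. `x² ∈ ℤ`) — the primes above `p` and above the bad `ℓ ∤ 2d_CM` in the
(d2) recipe, where `d_w = 0`. [cite: NeukirchANT1999, Ch. II §3 (strong triangle inequality)] -/
theorem ordAt_lin_eq_zero {ℓ : ℕ} (hℓ : ℓ.Prime) (w : HeightOneSpectrum (𝓞 K))
    (hw : ((ℓ : ℕ) : 𝓞 K) ∈ w.asIdeal) {x y : K} (hy0 : y ≠ 0) (hy : ordAt w y = 0) (hx : 0 ≤ ordAt w x)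
    {a b : ℤ} (ha : ¬ (ℓ : ℤ) ∣ a) (hb : (ℓ : ℤ) ∣ b) :
    ordAt w ((a : K) * y + (b : K) * x) = 0 := by
  have ha0 : a ≠ 0 := by rintro rfl; exact ha (dvd_zero _)
  have hay : ordAt w ((a : K) * y) = 0 := by
    rw [ordAt_mul w (by exact_mod_cast ha0) hy0, ordAt_intCast_eq_zero_of_not_dvd hℓ w hw ha, hy, add_zero]
  by_cases hbx : (b : K) * x = 0
  · rw [hbx, add_zero, hay]
  have hb0 : (b : K) ≠ 0 := fun h ↦ hbx (by rw [h, zero_mul])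
  have hx0 : x ≠ 0 := fun h ↦ hbx (by rw [h, mul_zero])
  have hb0' : b ≠ 0 := by exact_mod_cast hb0
  have hbx' : 0 < ordAt w ((b : K) * x) := by
    rw [ordAt_mul w hb0 hx0]
    have h1 := ramificationIdx_le_ordAt_intCast_of_dvd hℓ w hw hb0' hb
    have h2 : 0 < w.asIdeal.ramificationIdx ℤ := Ideal.ramificationIdx_pos _ _
    omega
  rw [ordAt_add_eq_left_of_lt w (mul_ne_zero (by exact_mod_cast ha0) hy0) (by rw [hay]; exact hbx'), hay]

/-- **TAME PRIMES: `ord_w(a·y + b·x) = 1`** when `ord_w(x) = 1` (`x ≠ 0`), `ℓ ∤ b`, `ℓ ∣ a` (so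
`ord_w(a) ≥ e(w∣ℓ) ≥ 2`) and `y` has `ord_w(y) ≥ 0` — the ramified odd primes `ℓ ∣ d_CM`, where `d_w = 1`.
[cite: NeukirchANT1999, Ch. II §3 (strong triangle inequality)] -/
theorem ordAt_lin_eq_one {ℓ : ℕ} (hℓ : ℓ.Prime) (w : HeightOneSpectrum (𝓞 K))
    (hw : ((ℓ : ℕ) : 𝓞 K) ∈ w.asIdeal) (he : 2 ≤ w.asIdeal.ramificationIdx ℤ) {x y : K} (hx0 : x ≠ 0)
    (hx : ordAt w x = 1) (hy : 0 ≤ ordAt w y) {a b : ℤ} (ha : (ℓ : ℤ) ∣ a) (hb : ¬ (ℓ : ℤ) ∣ b) :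
    ordAt w ((a : K) * y + (b : K) * x) = 1 := by
  have hb0 : b ≠ 0 := by rintro rfl; exact hb (dvd_zero _)
  have hbx : ordAt w ((b : K) * x) = 1 := by
    rw [ordAt_mul w (by exact_mod_cast hb0) hx0, ordAt_intCast_eq_zero_of_not_dvd hℓ w hw hb, hx, zero_add]
  by_cases hay : (a : K) * y = 0
  · rw [hay, zero_add, hbx]
  have ha0 : (a : K) ≠ 0 := fun h ↦ hay (by rw [h, zero_mul])
  have hy0 : y ≠ 0 := fun h ↦ hay (by rw [h, mul_zero])
  have ha0' : a ≠ 0 := by exact_mod_cast ha0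
  have hay' : 1 < ordAt w ((a : K) * y) := by
    rw [ordAt_mul w ha0 hy0]
    have h1 := ramificationIdx_le_ordAt_intCast_of_dvd hℓ w hw ha0' ha
    have h2 : (2 : ℤ) ≤ (w.asIdeal.ramificationIdx ℤ : ℤ) := by exact_mod_cast he
    omega
  rw [ordAt_add_eq_right_of_lt w (mul_ne_zero (by exact_mod_cast hb0) hx0) (by rw [hbx]; exact hay'), hbx]

/-- **DYADIC PRIMES, `d_CM = −4`: `ord_w(a·y + b·x) = 2`** when `ord_w(x) = 2`, `e(w∣2) = 2`, `2 ∥ a`,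
`y` a unit at `w` (`y ≠ 0`, `ord_w(y) = 0`) and `2 ∣ b` — where `d_w = 2`.
[cite: NeukirchANT1999, Ch. II §3 (strong triangle inequality)] -/
theorem ordAt_lin_eq_two (w : HeightOneSpectrum (𝓞 K)) (hw : ((2 : ℕ) : 𝓞 K) ∈ w.asIdeal)
    (he : w.asIdeal.ramificationIdx ℤ = 2) {x y : K} (hx : ordAt w x = 2) (hy0 : y ≠ 0) (hy : ordAt w y = 0)
    {a b : ℤ} (ha : (2 : ℤ) ∣ a) (ha4 : ¬ ((2 : ℤ) ^ 2) ∣ a) (hb : (2 : ℤ) ∣ b) :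
    ordAt w ((a : K) * y + (b : K) * x) = 2 := by
  have ha0 : a ≠ 0 := by rintro rfl; exact ha4 (dvd_zero _)
  have hay : ordAt w ((a : K) * y) = 2 := by
    rw [ordAt_mul w (by exact_mod_cast ha0) hy0, hy, add_zero]
    have := ordAt_intCast_eq_ramificationIdx_of_dvd_of_not_dvd Nat.prime_two w hw
      (by exact_mod_cast ha) (by exact_mod_cast ha4)
    rw [he] at this
    exact_mod_cast this
  by_cases hbx : (b : K) * x = 0
  · rw [hbx, add_zero, hay]
  have hb0 : (b : K) ≠ 0 := fun h ↦ hbx (by rw [h, zero_mul])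
  have hx0 : x ≠ 0 := fun h ↦ hbx (by rw [h, mul_zero])
  have hb0' : b ≠ 0 := by exact_mod_cast hb0
  have hbx' : 2 < ordAt w ((b : K) * x) := by
    rw [ordAt_mul w hb0 hx0, hx]
    have h1 := ramificationIdx_le_ordAt_intCast_of_dvd Nat.prime_two w hw hb0' (by exact_mod_cast hb)
    rw [he] at h1
    push_cast at h1
    omega
  rw [ordAt_add_eq_left_of_lt w (mul_ne_zero (by exact_mod_cast ha0) hy0) (by rw [hay]; exact hbx'), hay]

/-- **DYADIC PRIMES, `d_CM = −8`: `ord_w(a·y + b·x) = 3`** when `ord_w(x) = 3` (`x ≠ 0`), `e(w∣2) = 2`,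
`2 ∤ b`, `4 ∣ a` and `ord_w(y) ≥ 0` — where `d_w = 3`. [cite: NeukirchANT1999, Ch. II §3 (strong triangle inequality)] -/
theorem ordAt_lin_eq_three (w : HeightOneSpectrum (𝓞 K)) (hw : ((2 : ℕ) : 𝓞 K) ∈ w.asIdeal)
    (he : w.asIdeal.ramificationIdx ℤ = 2) {x y : K} (hx0 : x ≠ 0) (hx : ordAt w x = 3) (hy : 0 ≤ ordAt w y)
    {a b : ℤ} (ha : ((2 : ℤ) ^ 2) ∣ a) (hb : ¬ (2 : ℤ) ∣ b) :
    ordAt w ((a : K) * y + (b : K) * x) = 3 := by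
  have hb0 : b ≠ 0 := by rintro rfl; exact hb (dvd_zero _)
  have hbx : ordAt w ((b : K) * x) = 3 := by
    rw [ordAt_mul w (by exact_mod_cast hb0) hx0, hx,
      ordAt_intCast_eq_zero_of_not_dvd Nat.prime_two w hw (by exact_mod_cast hb), zero_add]
  by_cases hay : (a : K) * y = 0
  · rw [hay, zero_add, hbx]
  have ha0 : (a : K) ≠ 0 := fun h ↦ hay (by rw [h, zero_mul])
  have hy0 : y ≠ 0 := fun h ↦ hay (by rw [h, mul_zero])
  have ha0' : a ≠ 0 := by exact_mod_cast ha0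
  have hay' : 3 < ordAt w ((a : K) * y) := by
    rw [ordAt_mul w ha0 hy0]
    have h1 := two_mul_ramificationIdx_le_ordAt_intCast_of_sq_dvd Nat.prime_two w hw ha0' (by exact_mod_cast ha)
    rw [he] at h1
    push_cast at h1
    omega
  rw [ordAt_add_eq_right_of_lt w (mul_ne_zero (by exact_mod_cast hb0) hx0) (by rw [hbx]; exact hay'), hbx]

end Literature.NumberTheory.EllipticCurves

end
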